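import Literature.NumberTheory.LFunctions.WeilExplicit
import HarnessLib

/-!
# PF-persistence BARRIER, I: the four walls (publication cell `pub-rhpf`, barrier-prover seat) —
# which classes of "window invariants" cannot separate `ζ` from the negative controls, and why

Framing (page 1 of every `pub-rhpf` file): **long-odds MECHANISM SEARCH — nothing here is a claim
about RH.**  Every RH-bearing proposition below is an explicit HYPOTHESIS of a theorem or one side
of a proved `↔` with a tree theorem; the negativity of any specific control family is NEVER
asserted (it enters as a hypothesis `… ∈ Neg`, documented as observatory DATA in
`run/shared/lean/pub/pub-rhpf/pub-rhpf-barrier-prover/PROOF-PLAN.md`).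

## What is formalised (this file = abstract layer; II = `PfPersistenceBarrierExplicitDatum`,
## III = `PfPersistenceBarrierTwinsDials`, IV = `PfPersistenceBarrierCriterion`)

The search arm of the cell looks for a "spectral invariant" `P` of the window data of `ζ` that is
TRUE for `ζ` on all windows and FALSE on every negative control, hoping `P` is provable short of
RH.  This file proves, by cases over the STRUCTURE of `P`, when no such `P` exists
(`PROOF-PLAN.md` §2):

* **Abstract layer** (any record space `X`, distinguished record `z`, negative class `Neg`,
  `Discriminates P z Neg := P z ∧ ∀ y ∈ Neg, ¬ P y`):
  - W1 LOCALITY WALL `no_local_discriminator`: a predicate depending only on the windows in `S`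
    cannot discriminate if `Neg` contains a twin of `z` on `S`;
  - W2 ZERO-MARGIN WALL `no_eventually_discriminator`, `margin_nonpos_of_tendsto`,
    `no_margin_discriminator`: a predicate stable along a dial of negatives into `z`, or a margin
    continuous along such a dial, cannot discriminate — the best continuous margin is `0` at `z`;
  - W3 SEMANTIC WALL `pos_of_discriminates`, `exists_discriminates_iff`: against the semantic
    negative class `{x | ¬ Pos x}` a discriminator exists iff `Pos z` (so "the criterion is
    positivity-strength" is a tautology, recorded so that it is not re-derived as a result);
  - W4 UNIFORM-FAILURE WALL `failure_windows_escape`, `frequently_failure_outside`: an all-windows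
    predicate that is per-window stable along a dial of negatives must see the failure windows of
    the dialled negatives leave every finite window set.
* **Concrete layer** (explicit-formula data `ExplicitDatum` = smooth part + weighted point masses,
  `zetaDatum` with `zetaDatum.quadratic = weilQuadratic`):
  - prime LOCALITY `ExplicitDatum.quadratic_eq_of_agreeBelow` / `window_eq_of_agreeBelow`: data
    agreeing on the point masses of position `≤ 2A` have identical Weil windows `a ≤ A` (the
    autocorrelation `g ⋆ g̃` of a test supported in `[-a, a]` lives in `[-2a, 2a]`; same mechanism
    as the tree lemma `weilPrimeTerm_eq_sum_of_tsupport_subset`), whence twins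
    (`plantedDatum`, and every `G` with `AgreeBelow zetaDatum G (2A)`) and the Weil instance of W1
    `no_windowLocal_discriminator`;
  - the `lambdapert` DIAL `lambdapertDatum δ` (weights `(1+δ)Λ(n)/√n`):
    `lambdapertDatum_quadratic` (`Q_δ(g) = Q(g) − δ·P(g ⋆ g̃)`, affine in `δ`) and
    `tendsto_lambdapertDatum_window` (every window record is continuous in `δ` at `δ = 0`), whence
    the Weil instance of W2 `no_lambdapertStable_discriminator`;
  - the Weil instance of W3, `pfPersistence_criterion_iff_riemannHypothesis`:
    `(∃ P, Discriminates P zetaDatum {F | ¬ F.Positivity}) ↔ RiemannHypothesis`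
    (tree: `weil_criterion_holds`), and SHARPNESS `positivity_iff_forall_positivityOn` +
    `positivityOn_isWindowLocal`: positivity is the conjunction over `A` of the window-local (hence
    W1-dead) truncations — a limit of local invariants that is not local;
  - **RH-free negativity of the planted twins** `exists_plantedDatum_not_positivity` (a heavy mass
    at `± y` fails positivity, witnessed by a bump pair seeing the lag `y`), whence the
    UNCONDITIONAL barrier `no_windowLocal_criterion`: no window-local predicate, at any cutoff,
    discriminates `ζ` from the non-positive data (while the non-local conjunction does iff RH,
    `forall_positivityOn_discriminates_iff`).

References: E. Bombieri, Rend. Lincei (9) 11 (2000) 183–233, Thm 2 and §4 (bib `Bombieri2000Weil`);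
H. Yoshida, Adv. Stud. Pure Math. 21 (1992) 281–325, §2; H. G. Diamond, H. L. Montgomery,
U. Vorhauer, Math. Ann. 334 (2006) 1–36, Thm 1 (Beurling primes with RH_P false: the literature
model of the twins; tree `Literature.Barriers.RiemannHypothesis.DiamondMontgomeryVorhauer2006_thm1`).
-/

set_option linter.dupNamespace false

noncomputable section

open MeasureTheory Set Filter Complex
open scoped Real Topology ComplexConjugate ContDiff

namespace Summit.RiemannHypothesis.RiemannHypothesis.Theorems.PfPersistenceBarrier

open Literature.NumberTheory.LFunctions

/-! ## Abstract layer: discriminators, walls W1–W4 -/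

section Abstract

variable {X : Type*}

/-- `P` DISCRIMINATES the record `z` from the negative class `Neg`: true at `z`, false on all of
`Neg` (the success criterion of `pub-rhpf/INVARIANT.md` (a) ∧ (d)). [folklore] -/
def Discriminates (P : X → Prop) (z : X) (Neg : Set X) : Prop :=
  P z ∧ ∀ y ∈ Neg, ¬ P y

/-- A discriminator holds at the distinguished record. [folklore] -/
theorem Discriminates.self {P : X → Prop} {z : X} {Neg : Set X} (h : Discriminates P z Neg) :
    P z := h.1

/-- A discriminator fails on every negative. [folklore] -/
theorem Discriminates.not_of_mem {P : X → Prop} {z : X} {Neg : Set X}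
    (h : Discriminates P z Neg) {y : X} (hy : y ∈ Neg) : ¬ P y := h.2 y hy

/-- Discrimination is antitone in the negative class. [folklore] -/
theorem Discriminates.mono {P : X → Prop} {z : X} {Neg Neg' : Set X} (h : Discriminates P z Neg)
    (hsub : Neg' ⊆ Neg) : Discriminates P z Neg' :=
  ⟨h.1, fun y hy ↦ h.2 y (hsub hy)⟩

/-! ### W1 — locality / twin wall -/

section Locality

variable {W : Type*} {D : W → Type*}

/-- `P` is LOCAL on the window set `S`: it depends only on the values of a (dependent) record on
`S` (every invariant computed from a finite dataset is local on the dataset's windows; the record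
type `(v : W) → D v` covers the Galerkin data `(win : Window) → Matrix (Fin (win.N+1)) …` of
`Theorems/PfPersistenceAdmissibleClass.lean` as well as the Weil windows below). [folklore] -/
def IsLocal (P : ((v : W) → D v) → Prop) (S : Set W) : Prop :=
  ∀ x y : (v : W) → D v, (∀ w ∈ S, x w = y w) → (P x ↔ P y)

/-- `Neg` contains a TWIN of `z` on `S`: a record agreeing with `z` at every window of `S`. [folklore] -/
def HasTwinOn (z : (v : W) → D v) (Neg : Set ((v : W) → D v)) (S : Set W) : Prop :=
  ∃ y ∈ Neg, ∀ w ∈ S, y w = z w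

/-- Locality is inherited by larger window sets. [folklore] -/
theorem IsLocal.mono {P : ((v : W) → D v) → Prop} {S T : Set W} (h : IsLocal P S) (hST : S ⊆ T) :
    IsLocal P T :=
  fun x y hxy ↦ h x y fun w hw ↦ hxy w (hST hw)

/-- A twin on `T` is a twin on every `S ⊆ T`. [folklore] -/
theorem HasTwinOn.anti {z : (v : W) → D v} {Neg : Set ((v : W) → D v)} {S T : Set W} (h : HasTwinOn z Neg T)
    (hST : S ⊆ T) : HasTwinOn z Neg S := by
  obtain ⟨y, hy, hyz⟩ := h
  exact ⟨y, hy, fun w hw ↦ hyz w (hST hw)⟩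

/-- Twins persist in larger negative classes. [folklore] -/
theorem HasTwinOn.mono_neg {z : (v : W) → D v} {Neg Neg' : Set ((v : W) → D v)} {S : Set W}
    (h : HasTwinOn z Neg S) (hsub : Neg ⊆ Neg') : HasTwinOn z Neg' S := by
  obtain ⟨y, hy, hyz⟩ := h
  exact ⟨y, hsub hy, hyz⟩

/-- A conjunction of local predicates is local. [folklore] -/
theorem IsLocal.and {P Q : ((v : W) → D v) → Prop} {S : Set W} (hP : IsLocal P S) (hQ : IsLocal Q S) :
    IsLocal (fun x ↦ P x ∧ Q x) S :=
  fun x y hxy ↦ and_congr (hP x y hxy) (hQ x y hxy)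

/-- The negation of a local predicate is local. [folklore] -/
theorem IsLocal.not {P : ((v : W) → D v) → Prop} {S : Set W} (hP : IsLocal P S) :
    IsLocal (fun x ↦ ¬ P x) S :=
  fun x y hxy ↦ not_congr (hP x y hxy)

/-- A predicate reading a single window is local on any set containing it. [folklore] -/
theorem isLocal_eval {w : W} {S : Set W} (hw : w ∈ S) (Q : D w → Prop) :
    IsLocal (fun x : (v : W) → D v ↦ Q (x w)) S :=
  fun x y hxy ↦ by
    show Q (x w) ↔ Q (y w)
    rw [hxy w hw]

/-- **W1 (locality wall), positive form.** A predicate local on `S` and true at `z` is true at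
every twin of `z` on `S`; if `Neg` has such a twin, some negative record satisfies `P`. [folklore] -/
theorem exists_neg_of_isLocal {P : ((v : W) → D v) → Prop} {S : Set W} {z : (v : W) → D v} {Neg : Set ((v : W) → D v)}
    (hP : IsLocal P S) (htwin : HasTwinOn z Neg S) (hz : P z) : ∃ y ∈ Neg, P y := by
  obtain ⟨y, hy, hyz⟩ := htwin
  exact ⟨y, hy, (hP y z hyz).2 hz⟩

/-- **W1 (locality wall).** No predicate local on `S` discriminates `z` from a negative class
containing a twin of `z` on `S`.  In the cell's language: an invariant computable from the windows
in `S` takes the same value on `ζ` and on the twin; its discriminating content is nil. [folklore] -/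
theorem no_local_discriminator {P : ((v : W) → D v) → Prop} {S : Set W} {z : (v : W) → D v} {Neg : Set ((v : W) → D v)}
    (hP : IsLocal P S) (htwin : HasTwinOn z Neg S) : ¬ Discriminates P z Neg := by
  rintro ⟨hz, hno⟩
  obtain ⟨y, hy, hPy⟩ := exists_neg_of_isLocal hP htwin hz
  exact hno y hy hPy

/-- **W1 for a class.** If every member of the admissible class `𝒞` is local on some window set
on which `Neg` has a twin of `z`, the class contains no discriminator. [folklore] -/
theorem no_discriminator_in_local_class {𝒞 : Set (((v : W) → D v) → Prop)} {z : (v : W) → D v}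
    {Neg : Set ((v : W) → D v)} (h𝒞 : ∀ P ∈ 𝒞, ∃ S : Set W, IsLocal P S ∧ HasTwinOn z Neg S) :
    ¬ ∃ P ∈ 𝒞, Discriminates P z Neg := by
  rintro ⟨P, hP, hdisc⟩
  obtain ⟨S, hloc, htwin⟩ := h𝒞 P hP
  exact no_local_discriminator hloc htwin hdisc

end Locality

/-! ### W2 — zero-margin wall (stability along a dial of negatives) -/

/-- **W2 (stability wall).** If a dial `c` is eventually in `Neg` along a proper filter and `P`
holds eventually along the dial ("`P` is stable under the perturbation family"), then `P` does not
discriminate: "stable under the perturbation families" and "fails on every negative control" are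
jointly unsatisfiable as soon as one perturbation family consists of negatives. [folklore] -/
theorem no_eventually_discriminator {ι : Type*} {l : Filter ι} [l.NeBot] {c : ι → X}
    {P : X → Prop} {z : X} {Neg : Set X} (hNeg : ∀ᶠ i in l, c i ∈ Neg)
    (hstab : ∀ᶠ i in l, P (c i)) : ¬ Discriminates P z Neg := by
  rintro ⟨-, hno⟩
  obtain ⟨i, hi, hPi⟩ := (hNeg.and hstab).exists
  exact hno _ hi hPi

/-- **W2, topological form.** If `P` holds on a neighbourhood of `z` and a dial of negatives
converges to `z`, `P` does not discriminate. [folklore] -/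
theorem no_nhds_discriminator [TopologicalSpace X] {ι : Type*} {l : Filter ι} [l.NeBot]
    {c : ι → X} {P : X → Prop} {z : X} {Neg : Set X} (hc : Tendsto c l (𝓝 z))
    (hNeg : ∀ᶠ i in l, c i ∈ Neg) (hP : ∀ᶠ x in 𝓝 z, P x) : ¬ Discriminates P z Neg :=
  no_eventually_discriminator hNeg (hc.eventually hP)

/-- **W2 (zero margin).** A real margin `f`, continuous at `z` along a dial of negatives on which
`f ≤ 0`, satisfies `f z ≤ 0`: the one-signed region cannot contain `z` in its interior along the
dial — the best possible continuous margin at `z` is exactly `0`. [folklore] -/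
theorem margin_nonpos_of_tendsto {ι : Type*} {l : Filter ι} [l.NeBot] {c : ι → X} {f : X → ℝ}
    {z : X} {Neg : Set X} (hf : Tendsto (f ∘ c) l (𝓝 (f z))) (hNeg : ∀ᶠ i in l, c i ∈ Neg)
    (hfNeg : ∀ y ∈ Neg, f y ≤ 0) : f z ≤ 0 :=
  le_of_tendsto hf (hNeg.mono fun _ hi ↦ hfNeg _ hi)

/-- **W2 (no positive-margin discriminator).** With `f` continuous at `z` along a dial of
negatives, the strict-margin predicate `0 < f` does not discriminate. [folklore] -/
theorem no_margin_discriminator {ι : Type*} {l : Filter ι} [l.NeBot] {c : ι → X} {f : X → ℝ}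
    {z : X} {Neg : Set X} (hf : Tendsto (f ∘ c) l (𝓝 (f z))) (hNeg : ∀ᶠ i in l, c i ∈ Neg) :
    ¬ Discriminates (fun x ↦ 0 < f x) z Neg := by
  rintro ⟨hz, hno⟩
  have h : f z ≤ 0 := margin_nonpos_of_tendsto hf hNeg fun y hy ↦ not_lt.1 (hno y hy)
  exact (not_lt.2 h) hz

/-- **W2 (margin squeezed to zero).** If moreover `0 ≤ f z` (the weak inequality does hold at
`z`), the margin at `z` is exactly `0`. [folklore] -/
theorem margin_eq_zero_of_tendsto {ι : Type*} {l : Filter ι} [l.NeBot] {c : ι → X} {f : X → ℝ}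
    {z : X} {Neg : Set X} (hf : Tendsto (f ∘ c) l (𝓝 (f z))) (hNeg : ∀ᶠ i in l, c i ∈ Neg)
    (hfNeg : ∀ y ∈ Neg, f y ≤ 0) (hz : 0 ≤ f z) : f z = 0 :=
  le_antisymm (margin_nonpos_of_tendsto hf hNeg hfNeg) hz

/-! ### W3 — semantic wall -/

/-- **W3.** If the negative class contains every record failing `Pos`, any discriminator of `z`
certifies `Pos z`. [folklore] -/
theorem pos_of_discriminates {Pos P : X → Prop} {z : X} {Neg : Set X}
    (hNeg : ∀ x, ¬ Pos x → x ∈ Neg) (h : Discriminates P z Neg) : Pos z := by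
  by_contra hz
  exact h.2 z (hNeg z hz) h.1

/-- `Pos` itself discriminates iff it holds at `z`, for any negative class inside `{¬ Pos}`. [folklore] -/
theorem discriminates_self_iff {Pos : X → Prop} {z : X} {Neg : Set X}
    (hNeg : ∀ x ∈ Neg, ¬ Pos x) : Discriminates Pos z Neg ↔ Pos z :=
  ⟨fun h ↦ h.1, fun hz ↦ ⟨hz, hNeg⟩⟩

/-- **W3 (the criterion against the semantic negative class).** A discriminator of `z` from
`{x | ¬ Pos x}` exists iff `Pos z`. [folklore] -/
theorem exists_discriminates_iff {Pos : X → Prop} {z : X} :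
    (∃ P : X → Prop, Discriminates P z {x | ¬ Pos x}) ↔ Pos z :=
  ⟨fun ⟨_, h⟩ ↦ pos_of_discriminates (fun _ hx ↦ hx) h, fun hz ↦ ⟨Pos, hz, fun _ hy ↦ hy⟩⟩

/-- **W3 for a class.** Within ANY admissible class, a discriminator against a negative class
containing `{¬ Pos}` certifies `Pos z`; so restricting the class can only remove discriminators,
never make one cheaper than `Pos z`. [folklore] -/
theorem pos_of_exists_discriminates_in_class {𝒞 : Set (X → Prop)} {Pos : X → Prop} {z : X}
    {Neg : Set X} (hNeg : ∀ x, ¬ Pos x → x ∈ Neg) (h : ∃ P ∈ 𝒞, Discriminates P z Neg) :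
    Pos z := by
  obtain ⟨P, -, hP⟩ := h
  exact pos_of_discriminates hNeg hP

/-! ### W4 — uniform-failure wall (all-windows predicates) -/

/-- **W4.** Let `P x = ∀ w, Pw w x` be an all-windows predicate, per-window stable along a dial
`c` (`∀ w, ∀ᶠ i, Pw w (c i)`).  Then the dialled records cannot eventually fail inside a FIXED
finite window set `S`. [folklore] -/
theorem failure_windows_escape {ι W : Type*} {l : Filter ι} [l.NeBot] {c : ι → X}
    {Pw : W → X → Prop} (hstab : ∀ w, ∀ᶠ i in l, Pw w (c i)) (S : Finset W)
    (hfail : ∀ᶠ i in l, ∃ w ∈ S, ¬ Pw w (c i)) : False := by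
  have h : ∀ᶠ i in l, ∀ w ∈ S, Pw w (c i) :=
    (Filter.eventually_all_finset S).2 fun w _ ↦ hstab w
  obtain ⟨i, hi, w, hw, hnot⟩ := (h.and hfail).exists
  exact hnot (hi w hw)

/-- **W4, uniform form.** The same with any window set `S` on which stability is uniform. [folklore] -/
theorem failure_windows_escape_of_uniform {ι W : Type*} {l : Filter ι} [l.NeBot] {c : ι → X}
    {Pw : W → X → Prop} (S : Set W) (hstab : ∀ᶠ i in l, ∀ w ∈ S, Pw w (c i))
    (hfail : ∀ᶠ i in l, ∃ w ∈ S, ¬ Pw w (c i)) : False := by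
  obtain ⟨i, hi, w, hw, hnot⟩ := (hstab.and hfail).exists
  exact hnot (hi w hw)

/-- **W4 (the shape of a survivor).** If every dialled record fails the all-windows predicate
somewhere (as it must if the dial consists of negatives and `P` discriminates) and `P` is
per-window stable along the dial, then for every finite window set `S` the failures occur
FREQUENTLY OUTSIDE `S`: the failure windows leave every finite set ("uniformity in the window is
the door", `PROOF-PLAN.md` W4). [folklore] -/
theorem frequently_failure_outside {ι W : Type*} {l : Filter ι} [l.NeBot] {c : ι → X}
    {Pw : W → X → Prop} (hstab : ∀ w, ∀ᶠ i in l, Pw w (c i))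
    (hfail : ∀ᶠ i in l, ∃ w, ¬ Pw w (c i)) (S : Finset W) :
    ∃ᶠ i in l, ∃ w ∉ S, ¬ Pw w (c i) := by
  by_contra hcon
  rw [Filter.not_frequently] at hcon
  refine failure_windows_escape hstab S ((hfail.and hcon).mono ?_)
  rintro i ⟨⟨w, hw⟩, hout⟩
  by_cases hwS : w ∈ S
  · exact ⟨w, hwS, hw⟩
  · exact absurd ⟨w, hwS, hw⟩ hout

/-- **W4 applied to a discriminator.** An all-windows discriminator that is per-window stable
along a dial of negatives has, for every finite `S`, negatives on the dial failing outside `S`. [folklore] -/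
theorem Discriminates.frequently_failure_outside {ι W : Type*} {l : Filter ι} [l.NeBot]
    {c : ι → X} {Pw : W → X → Prop} {z : X} {Neg : Set X}
    (h : Discriminates (fun x ↦ ∀ w, Pw w x) z Neg) (hNeg : ∀ᶠ i in l, c i ∈ Neg)
    (hstab : ∀ w, ∀ᶠ i in l, Pw w (c i)) (S : Finset W) :
    ∃ᶠ i in l, ∃ w ∉ S, ¬ Pw w (c i) := by
  refine PfPersistenceBarrier.frequently_failure_outside hstab (hNeg.mono fun i hi ↦ ?_) S
  simpa using h.2 _ hi

end Abstract

end Summit.RiemannHypothesis.RiemannHypothesis.Theorems.PfPersistenceBarrier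

end
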